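import Summits.FinalStateConjecture.FinalStateConjecture.Theorems.SwallowTheDatumParametricKerrBurialLine
import Summits.FinalStateConjecture.FinalStateConjecture.Theorems.SwallowTheDatumParametricKerrBurialStubBreathing
import Literature.Geometry.Lorentzian.AFEndBreathing
import Literature.Geometry.Lorentzian.AFEndBreathingData
import Literature.Geometry.Lorentzian.AdmissibleDataLocality

/-!
# Route StarvedNecks — crux `HonestFixedRadiusSettling`, line `far-field-surgery`:
# stub `exists_breathingProbe` (anti-vacuity of the interior-probe clause)

The registered stub of the line skeleton `Cruxes/HonestFixedRadiusSettling/Lines/far_field_surgery.lean`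
asking, through every admissible datum `d` on the `3`-manifold `X` with an asymptotically flat end
`e` and a radius `R₀ > e.R`, for an INTERIOR PROBE: a family `t ↦ E t` of admissible data on `X`,
jointly smooth in `(t, x)` on `ℝ × X`, with `E 0 = d`, `E t = d` as sections (`AgreeAt`) on the far
region `e.far R₀ = {R₀ < ‖coord‖}`, together with a MARKER point `x₀ ∉ e.far R₀` and vector `v₀`
making `t ↦ h_{E t}(x₀)(v₀, v₀)` injective on `(-1, 1)`.

Construction (BREATHING, exactly the `E`-part of the landed stub `stub_breathing` of route
SwallowTheDatum, `Theorems/SwallowTheDatumParametricKerrBurialStubBreathing.lean`): inside the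
coordinate shell `{e.R < ‖coord‖ < R₀}` choose a breathing ball (`exists_breathingData_le`:
`AFEnd.BreathingData e z₀ r` with `‖z₀‖ + r ≤ R₀`) and pull `d` back along the breathing
diffeomorphisms `Φ_t = breathe (σ t)` supported in it, `E t := AFEnd.breatheFamily B d t`
(`Literature/Geometry/Lorentzian/AFEndBreathingData.lean`).  Then `E 0 = d`
(`AFEnd.breatheFamily_zero`); the sections are jointly smooth (`AFEnd.contMDiff_breatheFamily_h/k`);
`E t = d` on `e.far R₀` because the far region misses the compact moved set
(`AFEnd.breatheFamily_eq_of_mem_far`); every `E t` is admissible — vacuum by naturality of the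
constraints (`AFEnd.isVacuumConstraintSolution_breatheFamily`, valid for ALL `t` since the
amplitude `σ t` is squashed below the immersion/inverse threshold) and of the admissible class
because it agrees with `d` off the compact moved set
(`InitialDataSet.mem_admissibleVacuumData_of_agree_off_compact`); the marker at the centre
`x₀ = Φₑ z₀` (chart radius `‖z₀‖ < R₀`, so `x₀ ∉ e.far R₀`) with `v₀ = e₁` is
`h_{E t}(x₀)(v₀, v₀) = (1 + σ t)² h_d(x₀)(v₀, v₀)`, injective in `t` (`AFEnd.injective_marker`).

No definitions, no named facts; standard axioms.

References: R. Bartnik, J. Isenberg, *The constraint equations* (2004), §2 (diffeomorphism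
equivariance of the constraints); J. M. Lee, *Introduction to Smooth Manifolds* (2013), Prop. 2.25;
D. Christodoulou, CQG 16 (1999), p. A24 (the admissible class).
-/

-- the doubled `FinalStateConjecture` path component is the summit/problem naming scheme, not a mistake
set_option linter.dupNamespace false

noncomputable section

namespace Summit.FinalStateConjecture.FinalStateConjecture.Theorems.StarvedNecks.FarFieldSurgery

open scoped Manifold ContDiff Topology
open Set Filter Function Literature.Geometry.Lorentzian
open Summit.FinalStateConjecture.FinalStateConjecture.Theorems.SwallowTheDatum.ParametricKerrBurial
  (SmoothSectionsOn AgreeAt exists_breathingData_le not_mem_far_of_mem_carrier)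

/-- **Stub `exists_breathingProbe`** (registered signature, line `far-field-surgery`, crux item
stmt-FinalStateConjecture-13550): through every admissible datum `d` with an asymptotically flat end
`e` and every radius `R₀ > e.R` passes an interior probe — a jointly smooth family `t ↦ E t` of
admissible data with `E 0 = d`, `E t = d` as sections on `e.far R₀`, and a marker `x₀ ∉ e.far R₀`,
`v₀`, with `t ↦ h_{E t}(x₀)(v₀, v₀)` injective on `(-1, 1)`.  Proof: the breathing family
`E t = (breathe (σ t))^* d` of a breathing ball in the shell `{e.R < ‖coord‖ < R₀}`.
[cite: BartnikIsenberg2004, §2] -/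
theorem exists_breathingProbe :
  ∀ (X : Type) [TopologicalSpace X] [ChartedSpace E3 X] [IsManifold (𝓡 3) ∞ X] [T2Space X]
    [SecondCountableTopology X] [ConnectedSpace X] (d : InitialDataSet (𝓡 3) X) (e : AFEnd X) (R₀ : ℝ),
    d ∈ admissibleVacuumData X → e.R < R₀ →
      ∃ (E : ℝ → InitialDataSet (𝓡 3) X) (x₀ : X) (v₀ : TangentSpace (𝓡 3) x₀),
        SmoothSectionsOn 𝓘(ℝ, ℝ) E (Set.univ : Set (ℝ × X)) ∧ E 0 = d ∧
        (∀ t : ℝ, E t ∈ admissibleVacuumData X) ∧ (∀ t : ℝ, ∀ x ∈ e.far R₀, AgreeAt (E t) d x) ∧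
        x₀ ∉ e.far R₀ ∧ Set.InjOn (fun t : ℝ ↦ (E t).h.inner x₀ v₀ v₀) (Set.Ioo (-1) 1) := by
  intro X _ _ _ _ _ _ d e R₀ hd hR
  -- a breathing ball in the shell `{e.R < ‖coord‖ < R₀}` and the breathing family through `d`
  obtain ⟨z₀, r, B, hzr⟩ := exists_breathingData_le e hR
  let E : ℝ → InitialDataSet (𝓡 3) X := fun t ↦ AFEnd.breatheFamily B d t
  let x₀ : X := e.dataChartExt z₀
  let v₀ : TangentSpace (𝓡 3) x₀ := (EuclideanSpace.single 0 1 : E3)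
  have hv₀ : v₀ ≠ 0 := by
    intro h
    have h1 : ‖(EuclideanSpace.single (0 : Fin 3) (1 : ℝ) : E3)‖ = 1 := by simp
    have h2 : (EuclideanSpace.single (0 : Fin 3) (1 : ℝ) : E3) = 0 := h
    rw [h2, norm_zero] at h1
    exact zero_ne_one h1
  -- the datum `d` is vacuum (first clause of admissibility)
  have hvac : ∀ [d.metric.HasLeviCivita], d.IsVacuumConstraintSolution := fun {inst} ↦ (hd.1).1
  refine ⟨E, x₀, v₀, ⟨(AFEnd.contMDiff_breatheFamily_h B d).contMDiffOn,
    (AFEnd.contMDiff_breatheFamily_k B d).contMDiffOn⟩, AFEnd.breatheFamily_zero B d, fun t ↦ ?_,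
    fun t x hx ↦ AFEnd.breatheFamily_eq_of_mem_far B d t hzr hx, ?_, ?_⟩
  · -- admissibility of `E t`: vacuum by naturality, the end by locality (agreement off the moved set)
    refine InitialDataSet.mem_admissibleVacuumData_of_agree_off_compact hd ?_
      (AFEnd.isCompact_breatheCore B) (fun x hx ↦ AFEnd.breatheFamily_eq_of_not_mem_core B d t hx)
    intro inst
    haveI : d.metric.HasLeviCivita := d.metric.hasLeviCivita
    exact AFEnd.isVacuumConstraintSolution_breatheFamily B d hvac t
  · -- the marker point lies below `R₀`
    exact not_mem_far_of_mem_carrier e hzr le_rfl (AFEnd.center_mem B).1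
  · -- the marker is injective
    exact (AFEnd.injective_marker B d hv₀).injOn

end Summit.FinalStateConjecture.FinalStateConjecture.Theorems.StarvedNecks.FarFieldSurgery

end
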